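import Mathlib.RingTheory.MvPolynomial.WeightedHomogeneous
import Mathlib.RingTheory.Ideal.Quotient.Operations
import Mathlib.LinearAlgebra.Quotient.Basic
import Mathlib.Algebra.Algebra.Subalgebra.Basic
import HarnessLib

/-!
# The degree-`0` retraction of a graded hypersurface ring (crux `FInjectiveMacaulayfication`, line `Sketch`)

Support file for crux stmt-ResolutionOfSingularities-15315 (`FrobeniusLadder.FInjectiveMacaulayfication`,
line `Sketch`), stub `stub_gradeZeroRetractQuotient` of the cycle-9 WEIGHTED CONE ENGINE (§15 of the
skeleton). The polynomial ring `k[X] = MvPolynomial (Fin n) k` is graded by an additive group `M` through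
weights `W : Fin n → M`; `g` is weighted homogeneous of degree `δ`, `B = k[X]/(g)`, and `A ⊆ B` is the
`k`-subalgebra of classes of weighted-degree-`0` polynomials. This file supplies the "invariant projection"

* `stub_gradeZeroRetractQuotient` — there is an `A`-linear map `ρ : B → A` with `ρ ∘ (A ↪ B) = id`,
  namely `ρ (mk U) := mk (U₀)` with `U₀ = weightedHomogeneousComponent W 0 U` the degree-`0` component.

The only input about components is the COMPONENT LEMMA, taken as a hypothesis (it is proved in the lead's
toolkit): for `ψ` homogeneous of degree `δ'`, `(ψ u)_m = ψ · u_{m - δ'}`. From it: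
well-definedness on the quotient (`(g u)_0 = g · u_{-δ} ∈ (g)`), `A`-linearity
(`(V U)_0 = V · U_0` for `V` of degree `0`), and the retraction property (`V_0 = V`,
`MvPolynomial.weightedHomogeneousComponent_eq_self`). The map is built inside the proof from a
set-theoretic section of `Ideal.Quotient.mk` (`Ideal.Quotient.mk_surjective` + `choose`); no definitions,
no named facts. With `M = ℤ/e` and `W = (X_v ↦ 1, X_j ↦ -w_j)` this is the invariant projection of the
`μ_e`-root cover of a weighted blow-up chart, for every `e` (no tameness, no roots of unity needed).

## References

* [EGA II] A. Grothendieck, *Éléments de géométrie algébrique II*, Publ. Math. IHÉS 8 (1961), §2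
  (degree-zero parts of graded rings and their localizations); folklore.
-/

-- single-problem summit: the doubled namespace component is forced
set_option linter.dupNamespace false

namespace Summit.ResolutionOfSingularities.ResolutionOfSingularities.Theorems.FInjectiveMacaulayfication.GradeZeroRetractQuotient

open MvPolynomial

/-- **THE DEGREE-`0` RETRACTION OF A GRADED HYPERSURFACE RING**: `k[X]` graded by an additive group `M`
through weights `W`, `g` homogeneous of degree `δ`; `A ⊆ B = k[X]/(g)` the image of the degree-`0`
polynomials. Assuming the component lemma `(ψ u)_m = ψ · u_{m-δ'}` for `ψ` homogeneous of degree `δ'`,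
the degree-`0` component map `U ↦ U_0` descends to an `A`-linear retraction `ρ : B → A` of the inclusion:
`ρ (mk U) = mk U_0` is well defined since `(g u)_0 = g · u_{-δ} ∈ (g)`, `A`-linear since
`(V U)_0 = V · U_0` for `V` of degree `0`, and the identity on `A` since `V_0 = V`. [folklore] -/
theorem stub_gradeZeroRetractQuotient : ∀ (k : Type) [Field k] (n : ℕ) (M : Type) [AddCommGroup M] [DecidableEq M]
    (W : Fin n → M) (g : MvPolynomial (Fin n) k) (δ : M), MvPolynomial.IsWeightedHomogeneous W g δ →
    (∀ (ψ u : MvPolynomial (Fin n) k) (δ' m : M), MvPolynomial.IsWeightedHomogeneous W ψ δ' →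
      MvPolynomial.weightedHomogeneousComponent W m (ψ * u) =
        ψ * MvPolynomial.weightedHomogeneousComponent W (m - δ') u) →
    ∀ (A : Subalgebra k (MvPolynomial (Fin n) k ⧸ Ideal.span {g})),
    (∀ b : MvPolynomial (Fin n) k ⧸ Ideal.span {g}, b ∈ A ↔ ∃ U : MvPolynomial (Fin n) k,
      MvPolynomial.IsWeightedHomogeneous W U 0 ∧ Ideal.Quotient.mk (Ideal.span {g}) U = b) →
    ∃ ρ : (MvPolynomial (Fin n) k ⧸ Ideal.span {g}) →ₗ[A] A, ∀ x : A, ρ (x : MvPolynomial (Fin n) k ⧸ Ideal.span {g}) = x := by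
  intro k _ n M _ _ W g δ hg hcomp A hA
  -- (i) well-definedness of `U ↦ mk U_0` on the quotient: `(U - V)_0 = (g c)_0 = g · c_{-δ} ∈ (g)`
  have hwd : ∀ U V : MvPolynomial (Fin n) k,
      Ideal.Quotient.mk (Ideal.span {g}) U = Ideal.Quotient.mk (Ideal.span {g}) V →
      Ideal.Quotient.mk (Ideal.span {g}) (weightedHomogeneousComponent W 0 U) =
        Ideal.Quotient.mk (Ideal.span {g}) (weightedHomogeneousComponent W 0 V) := by
    intro U V h
    rw [Ideal.Quotient.eq] at h ⊢
    obtain ⟨c, hc⟩ := Ideal.mem_span_singleton.1 h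
    rw [← map_sub, hc, hcomp g c δ 0 hg]
    exact Ideal.mul_mem_right _ _ (Ideal.mem_span_singleton_self g)
  -- a set-theoretic section of `mk`
  have hsurj : ∀ b : MvPolynomial (Fin n) k ⧸ Ideal.span {g}, ∃ U : MvPolynomial (Fin n) k,
      Ideal.Quotient.mk (Ideal.span {g}) U = b := Ideal.Quotient.mk_surjective
  choose lift hlift using hsurj
  -- (ii) the image lies in `A`
  have hmemA : ∀ U : MvPolynomial (Fin n) k,
      Ideal.Quotient.mk (Ideal.span {g}) (weightedHomogeneousComponent W 0 U) ∈ A := fun U =>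
    (hA _).2 ⟨_, weightedHomogeneousComponent_isWeightedHomogeneous 0 U, rfl⟩
  refine ⟨{ toFun := fun b =>
              ⟨Ideal.Quotient.mk (Ideal.span {g}) (weightedHomogeneousComponent W 0 (lift b)), hmemA _⟩
            map_add' := ?_
            map_smul' := ?_ }, ?_⟩
  · -- additivity
    intro b₁ b₂
    apply Subtype.ext
    show Ideal.Quotient.mk (Ideal.span {g}) (weightedHomogeneousComponent W 0 (lift (b₁ + b₂))) =
      Ideal.Quotient.mk (Ideal.span {g}) (weightedHomogeneousComponent W 0 (lift b₁)) +
        Ideal.Quotient.mk (Ideal.span {g}) (weightedHomogeneousComponent W 0 (lift b₂))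
    rw [← map_add, ← map_add]
    apply hwd
    rw [map_add, hlift, hlift, hlift]
  · -- (iv) `A`-linearity: `a = mk V` with `V` of degree `0`, `(V U)_0 = V · U_0`
    intro a b
    obtain ⟨V, hV, hVa⟩ := (hA a).1 a.2
    apply Subtype.ext
    show Ideal.Quotient.mk (Ideal.span {g})
        (weightedHomogeneousComponent W 0 (lift ((a : MvPolynomial (Fin n) k ⧸ Ideal.span {g}) * b))) =
      (a : MvPolynomial (Fin n) k ⧸ Ideal.span {g}) *
        Ideal.Quotient.mk (Ideal.span {g}) (weightedHomogeneousComponent W 0 (lift b))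
    rw [hwd (lift ((a : MvPolynomial (Fin n) k ⧸ Ideal.span {g}) * b)) (V * lift b)
        (by rw [hlift, map_mul, hlift, hVa]),
      hcomp V (lift b) 0 0 hV, sub_zero, map_mul, hVa]
  · -- (iii) retraction: `x = mk V` with `V` of degree `0`, `V_0 = V`
    intro x
    obtain ⟨V, hV, hVx⟩ := (hA x).1 x.2
    apply Subtype.ext
    show Ideal.Quotient.mk (Ideal.span {g})
        (weightedHomogeneousComponent W 0 (lift (x : MvPolynomial (Fin n) k ⧸ Ideal.span {g}))) = x
    rw [hwd (lift (x : MvPolynomial (Fin n) k ⧸ Ideal.span {g})) V (by rw [hlift, hVx]),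
      weightedHomogeneousComponent_eq_self hV, hVx]

end Summit.ResolutionOfSingularities.ResolutionOfSingularities.Theorems.FInjectiveMacaulayfication.GradeZeroRetractQuotient
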